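import Literature.NumberTheory.EllipticCurves.RootNumberTwistSemistableProofs
import HarnessLib

/-!
# Proved cases of the local product formula `ε(f_E) = ∏ᶠ_v w_v(E)`

The named fact `WeierstrassCurve.frickeEigenvalue_eq_finprod_localRootNumberAt`
(`RootNumberProductFormulaProofs`; Kellock–Dokchitser 2023, Rem. 2.2 with Thm. 2.3: for an elliptic
`W / ℚ` with no additive reduction above `2, 3` and `f ∈ S₂(Γ₀(N_W))` its newform, the Fricke
eigenvalue `ε(f)` is the product `∏ᶠ_v w_v(E)` of Rohrlich's local root numbers) is, in the tree, the
per-prime named fact F1 = `WeierstrassCurve.atkinLehnerEigenvalueAt_eq_localRootNumberAt`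
(`λ_p(f) = w_p(E)` at `p ∣ N_W`) glued with two theorems: Atkin–Lehner's `ε(f) = ∏_{p ∣ N} λ_p(f)`
(`IsNewform0.frickeEigenvalue_eq_prod_atkinLehnerEigenvalueAt_holds`) and `w_v(E) = 1` at good `v`
(`frickeEigenvalue_eq_finprod_localRootNumberAt_of_localRootNumberAt`, `RootNumberAtkinLehnerTrustProofs`).
F1 is a theorem at the primes `p ∥ N_W` (`atkinLehnerEigenvalueAt_eq_localRootNumberAt_of_not_sq_dvd`)
and, from the Modularity Theorem `exists_isNewformOf`, at the additive primes `p ≥ 5` of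
quadratic-twist type (`atkinLehnerEigenvalueAt_eq_localRootNumberAt_of_twist`, `RootNumberTwistProofs`);
its remaining content (additive `p ≥ 5`, potentially good reduction with `e ∈ {3, 4, 6}`: ramified
principal series / supercuspidal local component) is local Langlands for `GL₂` with Carayol's
local–global compatibility (Kellock–Dokchitser 2023, Rem. 2.2), not in the tree.

This file records the cases of the product formula that are therefore PROVED:

* `frickeEigenvalue_eq_finprod_localRootNumberAt_of_squarefree` — **unconditionally for semistable
  `W`** (squarefree conductor): `ε(f) = ∏_{p ∣ N} w_p(E) = ∏_{p ∣ N} (−a_p(E))`, the modular-form side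
  of Kellock–Dokchitser's Cor. 2.5 (`w(E/ℚ) = (−1)^{m+1}`, `m` the number of split primes);
* `atkinLehnerEigenvalueAt_eq_localRootNumberAt_of_exists_isNewformOf_of_twist` and
  `frickeEigenvalue_eq_finprod_localRootNumberAt_of_exists_isNewformOf_of_twist` — F1 and the product
  formula **from the Modularity Theorem alone** for `W` with no additive reduction above `2, 3` all of
  whose additive primes are of quadratic-twist type (`E^{(p*)}` not additive at `p`);
* `frickeEigenvalue_eq_finprod_localRootNumberAt_quadraticTwist_of_squarefree` — in particular for
  every quadratic twist `E^{(d)}`, `d` squarefree, of a semistable `E` (its additive primes `p ≥ 5`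
  divide `d` and `(E^{(d)})^{(p*)} ≅ E^{(± d/p)}` is semistable at `p`,
  `not_hasAdditiveReductionAt_quadraticTwist_pStar_of_squarefree`, the argument of
  `rootNumber_eq_algebraicRootNumber_quadraticTwist_of_squarefree` in `RootNumberTwistSemistableProofs`).

Everything here is proved; no definitions and no named facts are introduced (D-0026).

## References

* [KellockDokchitser2023] L. Cowland Kellock, V. Dokchitser, *Root numbers and parity phenomena*,
  Bull. Lond. Math. Soc. 55 (2023), 2557–2597 (arXiv:2303.07883), Def. 2.1, Rem. 2.2, Thm. 2.3,
  Cor. 2.5.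
* [Knapp1993] A. W. Knapp, *Elliptic curves*, Princeton 1993, Thm. 9.27.
* [BCDTJAMS2001] C. Breuil, B. Conrad, F. Diamond, R. Taylor, J. Amer. Math. Soc. 14 (2001), Thm. A.
* [SilvermanAEC2009] J. H. Silverman, *The Arithmetic of Elliptic Curves*, 2nd ed., VII.5 Prop. 5.1,
  X.5 Cor. 5.4.
-/

noncomputable section

open scoped MatrixGroups Classical

open CongruenceSubgroup Literature.NumberTheory.EllipticCurves.ModularForms IsDedekindDomain
  IsDedekindDomain.HeightOneSpectrum NumberField Rat.HeightOneSpectrum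

namespace WeierstrassCurve

variable (W : WeierstrassCurve ℚ)

/-! ### Semistable curves: the product formula is a theorem -/

/-- **`ε(f) = ∏ᶠ_v w_v(E)` for a semistable `E / ℚ`, unconditionally.** If `N_W` is squarefree then
the named fact `W.frickeEigenvalue_eq_finprod_localRootNumberAt` holds outright: F1 is a theorem at
every `p ∥ N_W` (`atkinLehnerEigenvalueAt_eq_localRootNumberAt_of_squarefree`: `λ_p(f) = −a_p(f)`,
Knapp 1993 Thm. 9.27, and `w_p(E) = −a_p(E)` at multiplicative reduction, Kellock–Dokchitser 2023
Thm. 2.3 (iii),(iv)), and Atkin–Lehner's `ε(f) = ∏_{p ∣ N} λ_p(f)` is a theorem of the tree. This is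
the modular-form side of Kellock–Dokchitser's Cor. 2.5 (`w(E/ℚ) = (−1)^{m+1}` for semistable `E`,
`m` the number of primes of split multiplicative reduction).
[cite: KellockDokchitser2023, Rem. 2.2, Thm. 2.3 and Cor. 2.5] [cite: Knapp1993, Thm. 9.27] -/
theorem frickeEigenvalue_eq_finprod_localRootNumberAt_of_squarefree
    (hsq : Squarefree (W.conductorNorm ℤ)) : W.frickeEigenvalue_eq_finprod_localRootNumberAt :=
  W.frickeEigenvalue_eq_finprod_localRootNumberAt_of_localRootNumberAt
    (W.atkinLehnerEigenvalueAt_eq_localRootNumberAt_of_squarefree hsq)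

/-! ### Curves whose additive primes are of quadratic-twist type: from the Modularity Theorem -/

/-- **F1 from the Modularity Theorem for a curve whose additive primes are of quadratic-twist type.**
Let `W / ℚ` have no additive reduction above `2, 3` (`h23`) and suppose that at every additive prime
`p ≥ 5` the quadratic twist `E^{(p*)}`, `p* = (−1)^{(p−1)/2} p`, is not additive (`htw`: `E` has
potentially multiplicative reduction, or potentially good reduction with `e = 2`, at `p`). Then the
named fact `W.atkinLehnerEigenvalueAt_eq_localRootNumberAt` (Kellock–Dokchitser 2023, Rem. 2.2:
`λ_p(f) = w_p(E)` at every `p ∣ N_W`) follows from `exists_isNewformOf` (BCDT 2001, Thm. A): at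
`p ∥ N_W` by `atkinLehnerEigenvalueAt_eq_localRootNumberAt_of_not_sq_dvd`, and at `p² ∣ N_W` (additive,
hence `p ≥ 5` by `h23`) by `atkinLehnerEigenvalueAt_eq_localRootNumberAt_of_twist`
(`λ_p(f) = (−1/p) = w_p(E)`; Rohrlich 1993, Prop. 2). This is the per-prime step inlined in
`rootNumber_eq_algebraicRootNumber_of_exists_isNewformOf_of_twist` (`RootNumberTwistProofs`), recorded
as a statement of its own. [cite: KellockDokchitser2023, Rem. 2.2 and Thm. 2.3]
[cite: BCDTJAMS2001, Theorem A] -/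
theorem atkinLehnerEigenvalueAt_eq_localRootNumberAt_of_exists_isNewformOf_of_twist
    (hmod : exists_isNewformOf)
    (htw : ∀ p : Nat.Primes, 5 ≤ (p : ℕ) → W.HasAdditiveReductionAt ((primesEquiv (R := ℤ)).symm p) →
      ¬ (W.quadraticTwist (((-1 : ℤ) ^ ((p : ℕ) / 2) * p : ℤ) : ℚ)).HasAdditiveReductionAt
        ((primesEquiv (R := ℤ)).symm p))
    (h23 : ∀ v : HeightOneSpectrum ℤ, W.HasAdditiveReductionAt v → 3 < ringChar (ℤ ⧸ v.asIdeal)) :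
    W.atkinLehnerEigenvalueAt_eq_localRootNumberAt := by
  intro _ _ f hf p hp _
  by_cases hsq : (p : ℕ) ^ 2 ∣ W.conductorNorm ℤ
  · have hN0 : W.conductorNorm ℤ ≠ 0 := (W.conductorNorm_pos_holds).ne'
    have hgen : natGenerator ((primesEquiv (R := ℤ)).symm p) = p :=
      congrArg (fun q : Nat.Primes ↦ (q : ℕ)) ((primesEquiv (R := ℤ)).apply_symm_apply p)
    have h2 : 2 ≤ W.conductorExponent ((primesEquiv (R := ℤ)).symm p) := by
      rw [← factorization_conductorNorm_holds W ((primesEquiv (R := ℤ)).symm p), hgen]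
      exact (p.2.pow_dvd_iff_le_factorization hN0).mp hsq
    have hadd := (two_le_conductorExponent_iff_holds _ W).mp h2
    have h3 := h23 _ hadd
    rw [Literature.NumberTheory.EllipticCurves.Rat.ringChar_int_quotient_asIdeal, hgen] at h3
    have hp4 : (p : ℕ) ≠ 4 := fun h ↦ absurd p.2 (by rw [h]; norm_num)
    have hp5 : 5 ≤ (p : ℕ) := by omega
    exact W.atkinLehnerEigenvalueAt_eq_localRootNumberAt_of_twist hmod hf p hp5 hadd (htw p hp5 hadd) h23
  · exact W.atkinLehnerEigenvalueAt_eq_localRootNumberAt_of_not_sq_dvd hf p hp hsq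

/-- **`ε(f) = ∏ᶠ_v w_v(E)` from the Modularity Theorem for a curve whose additive primes are of
quadratic-twist type**: the named fact `W.frickeEigenvalue_eq_finprod_localRootNumberAt` (whose own
hypothesis excludes additive reduction above `2, 3`) for such `W`, from `exists_isNewformOf` alone —
F1 by `atkinLehnerEigenvalueAt_eq_localRootNumberAt_of_exists_isNewformOf_of_twist`, glued by
`frickeEigenvalue_eq_finprod_localRootNumberAt_of_localRootNumberAt` (Atkin–Lehner's
`ε(f) = ∏_{p ∣ N} λ_p(f)`, Knapp 1993 Thm. 9.27(c), a theorem of the tree).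
[cite: KellockDokchitser2023, Rem. 2.2 and Thm. 2.3] [cite: BCDTJAMS2001, Theorem A] -/
theorem frickeEigenvalue_eq_finprod_localRootNumberAt_of_exists_isNewformOf_of_twist
    (hmod : exists_isNewformOf)
    (htw : ∀ p : Nat.Primes, 5 ≤ (p : ℕ) → W.HasAdditiveReductionAt ((primesEquiv (R := ℤ)).symm p) →
      ¬ (W.quadraticTwist (((-1 : ℤ) ^ ((p : ℕ) / 2) * p : ℤ) : ℚ)).HasAdditiveReductionAt
        ((primesEquiv (R := ℤ)).symm p)) :
    W.frickeEigenvalue_eq_finprod_localRootNumberAt := by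
  intro _ _ h23 f hf
  exact W.frickeEigenvalue_eq_finprod_localRootNumberAt_of_localRootNumberAt
    (W.atkinLehnerEigenvalueAt_eq_localRootNumberAt_of_exists_isNewformOf_of_twist hmod htw h23) h23 hf

/-! ### Quadratic twists of semistable curves -/

/-- **The additive primes of a quadratic twist of a semistable curve are of quadratic-twist type.**
For `E / ℚ` semistable (squarefree conductor), `d` squarefree and `p ≥ 5` a prime at which `E^{(d)}`
is additive: `p ∣ d` (otherwise `d` is a `p`-adic unit and `E^{(d)}` has the reduction type of `E`
at `p`, `hasReductionAt_quadraticTwist_iff_of_not_dvd`; Silverman *AEC* VII.5 Prop. 5.1), so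
`d = p u` with `p ∤ u` and `(E^{(d)})^{(p*)} = E^{(± u p²)} ≅ E^{(± u)}`
(`exists_variableChange_smul_eq_quadraticTwist_sq`, *AEC* X.5 Cor. 5.4) is, like `E`, not additive at
`p`. This is the argument of `rootNumber_eq_algebraicRootNumber_quadraticTwist_of_squarefree`
(`RootNumberTwistSemistableProofs`), recorded as a statement of its own.
[cite: SilvermanAEC2009, VII.5 Prop. 5.1 and X.5 Cor. 5.4] [cite: KellockDokchitser2023, Rem. 2.2] -/
theorem not_hasAdditiveReductionAt_quadraticTwist_pStar_of_squarefree [W.IsElliptic]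
    (hsq : Squarefree (W.conductorNorm ℤ)) {d : ℤ} (hd : Squarefree d) (p : Nat.Primes)
    (hp5 : 5 ≤ (p : ℕ))
    (hadd : (W.quadraticTwist (d : ℚ)).HasAdditiveReductionAt ((primesEquiv (R := ℤ)).symm p)) :
    ¬ ((W.quadraticTwist (d : ℚ)).quadraticTwist (((-1 : ℤ) ^ ((p : ℕ) / 2) * p : ℤ) : ℚ)).HasAdditiveReductionAt
      ((primesEquiv (R := ℤ)).symm p) := by
  have hdZ : d ≠ 0 := hd.ne_zero
  haveI := W.isElliptic_quadraticTwist (show (d : ℚ) ≠ 0 by exact_mod_cast hdZ)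
  haveI := Fact.mk p.2
  have hgen : natGenerator ((primesEquiv (R := ℤ)).symm p) = p :=
    congrArg (fun q : Nat.Primes ↦ (q : ℕ)) ((primesEquiv (R := ℤ)).apply_symm_apply p)
  have hp2 : (p : ℕ) ≠ 2 := by omega
  have hv2 : natGenerator ((primesEquiv (R := ℤ)).symm p) ≠ 2 := by rwa [hgen]
  have hWna := W.not_hasAdditiveReductionAt_of_squarefree_conductorNorm hsq ((primesEquiv (R := ℤ)).symm p)
  -- `p ∣ d`, `d = p u` with `p ∤ u`
  have hpd : (p : ℤ) ∣ d := by
    by_contra h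
    exact hWna ((W.hasReductionAt_quadraticTwist_iff_of_not_dvd _ hv2 (d := d) (by rwa [hgen])).2.2.mp hadd)
  obtain ⟨u, hu⟩ := hpd
  have hu0 : u ≠ 0 := by rintro rfl; exact hdZ (by rw [hu, mul_zero])
  have hpu : ¬ ((p : ℕ) : ℤ) ∣ u := by
    rintro ⟨w, hw⟩
    have hunit : IsUnit ((p : ℕ) : ℤ) := hd p ⟨w, by rw [hu, hw]; ring⟩
    exact p.2.ne_one (Nat.isUnit_iff.mp (Int.ofNat_isUnit.mp hunit))
  -- `(E^{(d)})^{(p*)} = E^{(± u p²)} ≅ C • E^{(± u)}`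
  set s : ℤ := (-1 : ℤ) ^ ((p : ℕ) / 2) with hs
  have hsu0 : ((s * u : ℤ) : ℚ) ≠ 0 := by
    have : s * u ≠ 0 := mul_ne_zero (pow_ne_zero _ (by norm_num)) hu0
    exact_mod_cast this
  haveI := W.isElliptic_quadraticTwist hsu0
  have key : (W.quadraticTwist (d : ℚ)).quadraticTwist ((((-1 : ℤ) ^ ((p : ℕ) / 2) * p : ℤ)) : ℚ) =
      (W.quadraticTwist ((s * u : ℤ) : ℚ)).quadraticTwist (((p : ℕ) : ℚ) ^ 2) := by
    rw [quadraticTwist_quadraticTwist, quadraticTwist_quadraticTwist, hu, ← hs]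
    congr 1
    push_cast
    ring
  obtain ⟨C, hC⟩ := (W.quadraticTwist ((s * u : ℤ) : ℚ)).exists_variableChange_smul_eq_quadraticTwist_sq
    (θ := ((p : ℕ) : ℚ)) (by exact_mod_cast p.2.ne_zero)
  have hsu : ¬ ((natGenerator ((primesEquiv (R := ℤ)).symm p) : ℕ) : ℤ) ∣ s * u := by
    rw [hgen]
    intro h
    exact hpu (((isUnit_neg_one (α := ℤ)).pow _).dvd_mul_left.mp h)
  rw [key, ← hC, hasAdditiveReductionAt_smul_iff_holds _ (W.quadraticTwist ((s * u : ℤ) : ℚ)) C,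
    (W.hasReductionAt_quadraticTwist_iff_of_not_dvd _ hv2 hsu).2.2]
  exact hWna

/-- **`ε(f) = ∏ᶠ_v w_v(E^{(d)})` from the Modularity Theorem alone, for `E` semistable and `d`
squarefree**: the named fact `frickeEigenvalue_eq_finprod_localRootNumberAt` for the quadratic twist
`W.quadraticTwist d` (its own hypothesis excluding additive reduction of `E^{(d)}` above `2, 3`), from
`exists_isNewformOf` — the additive primes `p ≥ 5` of `E^{(d)}` are of quadratic-twist type
(`not_hasAdditiveReductionAt_quadraticTwist_pStar_of_squarefree`). (Kellock–Dokchitser 2023, Rem. 2.2: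
the local root numbers of such twists are classical, Thm. 2.3 (iii)–(v) and the case `e = 2` of (vii).)
[cite: KellockDokchitser2023, Rem. 2.2 and Thm. 2.3] [cite: BCDTJAMS2001, Theorem A] -/
theorem frickeEigenvalue_eq_finprod_localRootNumberAt_quadraticTwist_of_squarefree
    (hmod : exists_isNewformOf) [W.IsElliptic] (hsq : Squarefree (W.conductorNorm ℤ)) {d : ℤ}
    (hd : Squarefree d) : (W.quadraticTwist (d : ℚ)).frickeEigenvalue_eq_finprod_localRootNumberAt :=
  (W.quadraticTwist (d : ℚ)).frickeEigenvalue_eq_finprod_localRootNumberAt_of_exists_isNewformOf_of_twist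
    hmod (fun p hp5 hadd ↦ W.not_hasAdditiveReductionAt_quadraticTwist_pStar_of_squarefree hsq hd p hp5 hadd)

/-- The root number formula `w(E^{(d)}) = −∏_p W_p(E^{(d)})` of `RootNumberTwistSemistableProofs`
re-derived through `not_hasAdditiveReductionAt_quadraticTwist_pStar_of_squarefree` (same statement as
`rootNumber_eq_algebraicRootNumber_quadraticTwist_of_squarefree`; a consistency check of the factored
lemma, kept as an `example`). -/
example (hmod : exists_isNewformOf) [W.IsElliptic] (hsq : Squarefree (W.conductorNorm ℤ)) {d : ℤ}
    (hd : Squarefree d) : (W.quadraticTwist (d : ℚ)).rootNumber_eq_algebraicRootNumber :=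
  (W.quadraticTwist (d : ℚ)).rootNumber_eq_algebraicRootNumber_of_exists_isNewformOf_of_twist hmod
    (fun p hp5 hadd ↦ W.not_hasAdditiveReductionAt_quadraticTwist_pStar_of_squarefree hsq hd p hp5 hadd)

end WeierstrassCurve

end
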